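import Mathlib.RingTheory.PowerSeries.Basic
import Mathlib.Data.ZMod.Basic
import Mathlib.Order.SymmDiff
import Mathlib.LinearAlgebra.ExteriorAlgebra.Basis
import Literature.Computability.AlgebraicComplexity.GroupAlgebraTensor
import Literature.MathematicalPhysics.QuantumLattice.FermionOperators
import HarnessLib

/-!
# Structure tensors on the Boolean cube: exterior algebra, Clifford algebra, Rees family

Topic `Literature/Computability/AlgebraicComplexity`. Definition item `defn-exteriorTensor`
(wanted by route `MatrixMultiplication/HenselReesLifting`, items
`stmt-MatrixMultiplication-3849 … 3857`, which inline all four tensors below verbatim as lambdas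
over `Finset (Fin n)`).

All tensors are coordinate 3-tensors `Finset (Fin n) → Finset (Fin n) → Finset (Fin n) → K` on the
`2^n`-point Boolean cube (basis `e_S`, `S ⊆ {0, …, n-1}`), with the index convention of
`matMulTensor` / `structureTensor` (`GroupAlgebraTensor.lean`): **output coordinate first**,
`t U S T =` coefficient of `e_U` in the product `e_S · e_T`.

## Content

* `crossInversions S T = inv(S,T) = #{(s,t) ∈ S × T : t < s}` — the number of order inversions
  of the concatenation of the increasing enumerations of `S` and `T`; Artin's sign
  `∏_{s ∈ S, t ∈ T} (s,t)` (with `(s,t) = +1` if `s ≤ t`, `-1` if `s > t`) is `(-1)^{inv(S,T)}`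
  (Artin 1957/1988, Ch. V §4, p. 186). API: `crossInversions_eq_sum_left/right`,
  `crossInversions_insert_left`, `crossInversions_singleton_left`, `crossInversions_le`.
* `exteriorTensor K n` — `T_{Λ_n}(U,S,T) = [S ∩ T = ∅][U = S ∪ T] (-1)^{inv(S,T)}`: the structure
  tensor of the exterior algebra `Λ(K^n)` in the basis `e_S = e_{s_1} ∧ ⋯ ∧ e_{s_k}`
  (`s_1 < ⋯ < s_k`) (Brand–Dell–Husfeldt 2018, §2.1: `e_I ∧ e_J = 0` if `I ∩ J ≠ ∅`, else
  `(-1)^{sgn(I,J)} e_{I ∪ J}` with `sgn(I,J)` the sign of the permutation sorting the concatenation;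
  Artin's formula with `A_i² = 0`). **PROVED faithful**: `structureTensor_basis_exteriorAlgebra` —
  for every basis `b` of a `K`-module `M` indexed by `Fin n`, the structure tensor
  (`structureTensor`, BCS 1997, Def. (14.17)) of `ExteriorAlgebra K M` in Mathlib's basis
  `b.ExteriorAlgebra : Basis (Finset (Fin n)) K (ExteriorAlgebra K M)` IS `exteriorTensor K n`
  (via the multiplication table `basis_exteriorAlgebra_mul`).
* `cliffordTensor K n` — `T_{Cl_n}(U,S,T) = [U = S Δ T] (-1)^{inv(S,T)}`: the structure tensor of
  the Clifford algebra `C(V)` of an `n`-dimensional quadratic space with orthonormal basis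
  `A_1, …, A_n`, `A_i² = 1`, in Artin's basis `e_S = A_{s_1} ∘ ⋯ ∘ A_{s_k}`:
  `e_S ∘ e_T = ∏_{s∈S,t∈T} (s,t) · ∏_{i ∈ S∩T} A_i² · e_{S+T}`, `S + T` the symmetric difference
  (Artin 1988, Ch. V §4, p. 186; Garling 2011, §5.1, proof of Prop. 5.1.1: `e_C e_D = ± e_{CΔD}`).
* `reesCliffordTensor K n` — `T_t(U,S,T) = [U = S Δ T] t^{|S ∩ T|} (-1)^{inv(S,T)}` over `K⟦t⟧`:
  Artin's formula for the orthogonal basis with `A_i² = t` for all `i`, i.e. the structure tensor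
  of the Clifford algebra of the quadratic module `(K⟦t⟧^n, t·(x_1² + ⋯ + x_n²))`; its fibre at
  `t = 0` is `T_{Λ_n}` (`constantCoeff_reesCliffordTensor`) and the sum of its coefficients
  (value at `t = 1`) is `T_{Cl_n}` (`sum_coeff_reesCliffordTensor`; entries are the monomials
  `T_{Cl_n}(U,S,T) · t^{|S∩T|}`, `coeff_reesCliffordTensor`). Remark (not formalised): with
  `t = ε²`, `T_{ε²}(U,S,T) = ε^{|S|+|T|-|U|} T_{Cl_n}(U,S,T)`, i.e. `T_{ε²}` is `T_{Cl_n}` written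
  in the rescaled basis `ε^{|S|} e_S` — a one-parameter family of the kind by which
  Bläser–Lysikov 2016, §2.3 define the algebraic degeneration `Λ_n = gr Cl_n ⊴ Cl_n`.
* `dualNumberTensor K n` — `T_{D_n}(U,S,T) = [S ∩ T = ∅][U = S ∪ T]`: Artin's formula with
  `A_i² = 0` and all signs `+1`, the structure tensor of the commutative algebra
  `D_n = K[x_1,…,x_n]/(x_1²,…,x_n²) = (K[x]/x²)^{⊗ n}` in the monomial basis `x_S = ∏_{i∈S} x_i`;
  over any `K` with `-1 = 1` (e.g. `ZMod 2`) it coincides with `T_{Λ_n}`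
  (`exteriorTensor_zmod_two`; Brand–Dell–Husfeldt 2018, §4.2, Prop. 13: in characteristic two
  `Λ(F^k) ≅ F[ℤ_2^k]`) and with `T_{Cl_n}` cut down to disjoint pairs
  (`ite_disjoint_cliffordTensor_zmod_two`).
* Bookkeeping wanted by the route: `rfl` bridges to the inlined lambdas (`exteriorTensor_eq`,
  `cliffordTensor_eq`, `reesCliffordTensor_eq`, `dualNumberTensor_eq`); extension of scalars along
  a ring homomorphism fixes all four (`exteriorTensor_map`, `cliffordTensor_map`,
  `reesCliffordTensor_map`, `dualNumberTensor_map`; entries are `0`, `±1`, `± t^k`);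
  `exteriorTensor_eq_ite_cliffordTensor` (`T_{Λ_n}` is `T_{Cl_n}` restricted to disjoint pairs);
  units and generators (`e_∅` is a two-sided unit, `A_i ∘ A_i = 1` in `Cl_n`, `e_i ∧ e_i = 0`,
  `A_i ∘ A_j = -A_j ∘ A_i`).

## Sources

* E. Artin, *Geometric Algebra*, Interscience 1957 / Wiley Classics 1988 (held:
  `book:artin1988-geometric-algebra`), Ch. V §4 "The Clifford algebra", pp. 186–188: the basis
  `e_S` (`S ⊆ {1,…,n}`), the product formula `e_S ∘ e_T = ∏(s,t) · ∏_{i∈S∩T} A_i² · e_{S+T}`, its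
  associativity, `e_∅` the unit, `A_i ∘ A_i = A_i²`, `A_i ∘ A_j + A_j ∘ A_i = 0`. [Artin1988]
* D. J. H. Garling, *Clifford Algebras: An Introduction*, LMS Student Texts 78, CUP 2011 (held),
  §5.1, Prop. 5.1.1 and its proof (`e_C e_D = 0` or `± e_{CΔD}`). [Garling2011]
* C. Brand, H. Dell, T. Husfeldt, *Extensor-coding*, STOC 2018, arXiv:1804.09448, §2.1 (concrete
  definition of `Λ(F^k)` on the basis `e_I`), §4.2 Prop. 13 (characteristic two).
  [BrandDellHusfeldt2018]
* M. Bläser, V. Lysikov, *On degeneration of tensors and algebras*, MFCS 2016, arXiv:1606.04253,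
  §2.2–2.3 (degenerations via one-parameter families). [BlaserLysikov2016]
* P. Bürgisser, M. Clausen, M. A. Shokrollahi, *Algebraic Complexity Theory*, Springer 1997,
  Def. (14.17) (structural tensor of an algebra). [BurgisserClausenShokrollahi1997]

## Design choices

* Index type `Finset (Fin n)` and the literal shape of the `if … then … else` bodies are those of
  the route items, so that `exteriorTensor ℂ n`, `cliffordTensor ℂ n`, `reesCliffordTensor ℂ n`,
  `dualNumberTensor (ZMod 2) n` unfold to the inlined lambdas by `rfl` (the `_eq` lemmas); the
  decidability instances are Mathlib's (`Finset.decidableDisjoint`, `DecidableEq (Finset _)`,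
  `Fin.decLt`), as in the route file.
* Scalars: `CommRing K` for the signed tensors (the route uses `ℂ`, `ZMod 2`, the valuation ring of
  `Q̄_2`, `PowerSeries ℂ`); `CommSemiring K` for `dualNumberTensor`; `crossInversions` needs no
  scalars.
  The Rees tensor takes its values in `PowerSeries K` (the route's `PowerSeries ℂ`), although its
  entries are monomials, because the route takes ranks over `ℂ⟦t⟧`.
* Mathlib has `ExteriorAlgebra`, its `Finset`-indexed basis `Module.Basis.ExteriorAlgebra` with the
  multiplication rule `ExteriorAlgebra.basis_mul_of_disjoint` (sign of `permOfDisjoint`), and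
  `CliffordAlgebra Q`, but no coordinate structure tensors and no `Finset`-indexed basis of a
  Clifford algebra; the exterior table is proved against Mathlib here (through the tree's
  `ι_mul_basisExteriorAlgebra`, `FermionOperators.lean`), the Clifford and Rees tables are vendored
  as printed by Artin (his associativity proof, Ch. V §4, is not formalised here).
* NOT here (route items, not literature): `Cl_{2k} ≅ M_{2^k}` at tensor level
  (`CliffordMatrixModel`), rank bounds for `T_{D_n}` (`SpecialFibreSolved`), any (border) rank or
  asymptotic-rank statement about these tensors.
-/

noncomputable section

open scoped BigOperators

namespace Literature.Computability.AlgebraicComplexity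

universe u

/-! ## Cross inversions `inv(S,T)` -/

section CrossInversions

variable {n : ℕ}

/-- The number of **cross inversions** `inv(S,T) = #{(s,t) ∈ S × T : t < s}` between two subsets
of `{0,…,n-1}`: the number of order inversions in the concatenation of the increasing enumerations
of `S` and `T`, so that Artin's sign `∏_{s∈S, t∈T} (s,t)` (`(s,t) = 1` if `s ≤ t`, `-1` if `s > t`)
equals `(-1)^{inv(S,T)}` (Artin 1988, Ch. V §4, p. 186). [cite: Artin1988, Ch. V §4, p. 186] -/
def crossInversions (S T : Finset (Fin n)) : ℕ :=
  ((S ×ˢ T).filter (fun p : Fin n × Fin n => p.2 < p.1)).card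

/-- Unfolding `crossInversions`. [folklore] -/
theorem crossInversions_def (S T : Finset (Fin n)) :
    crossInversions S T = ((S ×ˢ T).filter (fun p : Fin n × Fin n => p.2 < p.1)).card := rfl

/-- `inv(S,T) = ∑_{s ∈ S} #{t ∈ T : t < s}`. [folklore] -/
theorem crossInversions_eq_sum_left (S T : Finset (Fin n)) :
    crossInversions S T = ∑ s ∈ S, (T.filter (· < s)).card := by
  unfold crossInversions
  rw [Finset.card_filter, Finset.sum_product]
  refine Finset.sum_congr rfl fun s _ => ?_
  rw [Finset.card_filter]

/-- `inv(S,T) = ∑_{t ∈ T} #{s ∈ S : t < s}`. [folklore] -/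
theorem crossInversions_eq_sum_right (S T : Finset (Fin n)) :
    crossInversions S T = ∑ t ∈ T, (S.filter (t < ·)).card := by
  unfold crossInversions
  rw [Finset.card_filter, Finset.sum_product_right]
  refine Finset.sum_congr rfl fun t _ => ?_
  rw [Finset.card_filter]

/-- `inv(∅,T) = 0`. [folklore] -/
@[simp] theorem crossInversions_empty_left (T : Finset (Fin n)) : crossInversions ∅ T = 0 := by
  simp [crossInversions_eq_sum_left]

/-- `inv(S,∅) = 0`. [folklore] -/
@[simp] theorem crossInversions_empty_right (S : Finset (Fin n)) : crossInversions S ∅ = 0 := by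
  simp [crossInversions_eq_sum_right]

/-- `inv({a},T) = #{t ∈ T : t < a}`. [folklore] -/
theorem crossInversions_singleton_left (a : Fin n) (T : Finset (Fin n)) :
    crossInversions {a} T = (T.filter (· < a)).card := by
  simp [crossInversions_eq_sum_left]

/-- `inv({a},{b}) = [b < a]`. [folklore] -/
theorem crossInversions_singleton_singleton (a b : Fin n) :
    crossInversions {a} {b} = if b < a then 1 else 0 := by
  rw [crossInversions_singleton_left, Finset.filter_singleton]
  split_ifs <;> simp

/-- Adjoining an element on the left: `inv(S ∪ {a}, T) = #{t ∈ T : t < a} + inv(S,T)` for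
`a ∉ S`. [folklore] -/
theorem crossInversions_insert_left {a : Fin n} {S : Finset (Fin n)} (h : a ∉ S)
    (T : Finset (Fin n)) :
    crossInversions (insert a S) T = (T.filter (· < a)).card + crossInversions S T := by
  rw [crossInversions_eq_sum_left, crossInversions_eq_sum_left, Finset.sum_insert h]

/-- `inv(S,T) ≤ |S|·|T|`. [folklore] -/
theorem crossInversions_le (S T : Finset (Fin n)) : crossInversions S T ≤ S.card * T.card := by
  rw [crossInversions_def, ← Finset.card_product]
  exact Finset.card_filter_le _ _

end CrossInversions

/-! ## The four structure tensors -/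

section Defs

variable (K : Type u)

/-- The **structure tensor `T_{Λ_n}` of the exterior algebra** `Λ(K^n)` in the basis
`e_S = e_{s_1} ∧ ⋯ ∧ e_{s_k}` (`S = {s_1 < ⋯ < s_k} ⊆ {0,…,n-1}`), output index first:
`T_{Λ_n}(U,S,T) =` coefficient of `e_U` in `e_S ∧ e_T`, which is `(-1)^{inv(S,T)}` if `S ∩ T = ∅`
and `U = S ∪ T`, and `0` otherwise (Brand–Dell–Husfeldt 2018, §2.1: `e_I ∧ e_J = 0` if
`I ∩ J ≠ ∅`, else `(-1)^{sgn(I,J)} e_{I∪J}`, `sgn(I,J)` = sign of the permutation sorting the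
concatenation `I, J`, whose parity is `inv(I,J)`; Artin 1988, Ch. V §4 with `A_i² = 0`). Proved
equal to the structure tensor of Mathlib's `ExteriorAlgebra` in `Module.Basis.ExteriorAlgebra`:
`structureTensor_basis_exteriorAlgebra`. [cite: BrandDellHusfeldt2018, §2.1] -/
def exteriorTensor [CommRing K] (n : ℕ) : Finset (Fin n) → Finset (Fin n) → Finset (Fin n) → K :=
  fun U S T => if Disjoint S T ∧ U = S ∪ T then (-1 : K) ^ crossInversions S T else 0

/-- The **structure tensor `T_{Cl_n}` of the Clifford algebra** `Cl_n = C(V)`, `V` an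
`n`-dimensional quadratic space with orthogonal basis `A_1,…,A_n`, `A_i² = 1`, in Artin's basis
`e_S = A_{s_1} ∘ ⋯ ∘ A_{s_k}` (`S ⊆ {0,…,n-1}` increasing), output index first:
`T_{Cl_n}(U,S,T) =` coefficient of `e_U` in `e_S ∘ e_T = ∏_{s∈S,t∈T} (s,t) · e_{S+T}`, i.e.
`(-1)^{inv(S,T)}` if `U = S Δ T` (symmetric difference) and `0` otherwise (Artin 1988, Ch. V §4,
p. 186, with all `A_i² = 1`; Garling 2011, §5.1: `e_C e_D = ± e_{CΔD}`). Relations `A_i ∘ A_i = 1`,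
`A_i ∘ A_j = -A_j ∘ A_i`: `cliffordTensor_singleton_singleton_self`,
`cliffordTensor_singleton_swap`.
[cite: Artin1988, Ch. V §4, p. 186] -/
def cliffordTensor [CommRing K] (n : ℕ) : Finset (Fin n) → Finset (Fin n) → Finset (Fin n) → K :=
  fun U S T => if U = symmDiff S T then (-1 : K) ^ crossInversions S T else 0

/-- The **Rees family `T_t` joining `T_{Λ_n}` (`t = 0`) to `T_{Cl_n}` (`t = 1`)**, over the power
series ring `K⟦t⟧`: `T_t(U,S,T) = t^{|S∩T|} (-1)^{inv(S,T)}` if `U = S Δ T` and `0` otherwise —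
Artin's product `e_S ∘ e_T = ∏(s,t) · ∏_{i∈S∩T} A_i² · e_{S+T}` for an orthogonal basis with
`A_i² = t` for every `i` (Artin 1988, Ch. V §4, p. 186), i.e. the structure tensor of the Clifford
algebra of the quadratic module `(K⟦t⟧^n, t·(x_1²+⋯+x_n²))` in the basis `e_S` — the
one-parameter family of multiplication tables joining `Cl_n` (`t = 1`) to `Λ_n = gr Cl_n`
(`t = 0`) (cf. Bläser–Lysikov 2016, §2.3, algebraic degenerations). Fibres:
`constantCoeff_reesCliffordTensor` (`t = 0`: `T_{Λ_n}`), `sum_coeff_reesCliffordTensor`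
(`t = 1`: `T_{Cl_n}`). [cite: Artin1988, Ch. V §4, p. 186] -/
def reesCliffordTensor [CommRing K] (n : ℕ) :
    Finset (Fin n) → Finset (Fin n) → Finset (Fin n) → PowerSeries K :=
  fun U S T => if U = symmDiff S T then
    (PowerSeries.X : PowerSeries K) ^ (S ∩ T).card * (-1 : PowerSeries K) ^ crossInversions S T
    else 0

/-- The **structure tensor `T_{D_n}` of the truncated polynomial algebra**
`D_n = K[x_1,…,x_n]/(x_1²,…,x_n²) ≅ (K[x]/(x²))^{⊗n}` (tensor power of the dual numbers) in the
monomial basis `x_S = ∏_{i∈S} x_i`, output index first: `T_{D_n}(U,S,T) = 1` if `S ∩ T = ∅` and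
`U = S ∪ T` (`x_S x_T = x_{S∪T}`), `0` otherwise (`x_S x_T = 0` when `S ∩ T ≠ ∅`) — Artin's formula
with `A_i² = 0` and all signs `+1`; the unsigned shadow of `T_{Λ_n}`, equal to it whenever `-1 = 1`
in `K` (`exteriorTensor_zmod_two`; Brand–Dell–Husfeldt 2018, §4.2, Prop. 13). [folklore] -/
def dualNumberTensor [CommSemiring K] (n : ℕ) :
    Finset (Fin n) → Finset (Fin n) → Finset (Fin n) → K :=
  fun U S T => if Disjoint S T ∧ U = S ∪ T then (1 : K) else 0

end Defs

/-! ## Entries and `rfl` bridges to the inlined route lambdas -/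

section Apply

variable {K : Type u} {n : ℕ}

/-- Entries of `T_{Λ_n}`. [folklore] -/
@[simp] theorem exteriorTensor_apply [CommRing K] (U S T : Finset (Fin n)) :
    exteriorTensor K n U S T =
      if Disjoint S T ∧ U = S ∪ T then (-1 : K) ^ crossInversions S T else 0 := rfl

/-- Entries of `T_{Cl_n}`. [folklore] -/
@[simp] theorem cliffordTensor_apply [CommRing K] (U S T : Finset (Fin n)) :
    cliffordTensor K n U S T = if U = symmDiff S T then (-1 : K) ^ crossInversions S T else 0 :=
  rfl

/-- Entries of `T_t`. [folklore] -/
@[simp] theorem reesCliffordTensor_apply [CommRing K] (U S T : Finset (Fin n)) :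
    reesCliffordTensor K n U S T = if U = symmDiff S T then
      (PowerSeries.X : PowerSeries K) ^ (S ∩ T).card * (-1 : PowerSeries K) ^ crossInversions S T
      else 0 := rfl

/-- Entries of `T_{D_n}`. [folklore] -/
@[simp] theorem dualNumberTensor_apply [CommSemiring K] (U S T : Finset (Fin n)) :
    dualNumberTensor K n U S T = if Disjoint S T ∧ U = S ∪ T then (1 : K) else 0 := rfl

variable (K n)

/-- **Bridge** to the lambda inlined in route `MatrixMultiplication/HenselReesLifting` (items
`stmt-MatrixMultiplication-3849/3850/3851/3853/3856`): definitional. [folklore] -/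
theorem exteriorTensor_eq [CommRing K] : exteriorTensor K n = fun U S T : Finset (Fin n) =>
    if Disjoint S T ∧ U = S ∪ T then
      (-1 : K) ^ ((S ×ˢ T).filter (fun p : Fin n × Fin n => p.2 < p.1)).card else 0 := rfl

/-- **Bridge** to the lambda inlined in route `MatrixMultiplication/HenselReesLifting` (items
`stmt-MatrixMultiplication-3849/3851/3854`): definitional. [folklore] -/
theorem cliffordTensor_eq [CommRing K] : cliffordTensor K n = fun U S T : Finset (Fin n) =>
    if U = symmDiff S T then
      (-1 : K) ^ ((S ×ˢ T).filter (fun p : Fin n × Fin n => p.2 < p.1)).card else 0 := rfl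

/-- **Bridge** to the lambda inlined in route `MatrixMultiplication/HenselReesLifting` (item
`stmt-MatrixMultiplication-3853`): definitional. [folklore] -/
theorem reesCliffordTensor_eq [CommRing K] : reesCliffordTensor K n = fun U S T : Finset (Fin n) =>
    if U = symmDiff S T then (PowerSeries.X : PowerSeries K) ^ (S ∩ T).card *
      (-1 : PowerSeries K) ^ ((S ×ˢ T).filter (fun p : Fin n × Fin n => p.2 < p.1)).card
    else 0 := rfl

/-- **Bridge** to the lambda inlined in route `MatrixMultiplication/HenselReesLifting` (item
`stmt-MatrixMultiplication-3855`): definitional. [folklore] -/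
theorem dualNumberTensor_eq [CommSemiring K] : dualNumberTensor K n = fun U S T : Finset (Fin n) =>
    if Disjoint S T ∧ U = S ∪ T then (1 : K) else 0 := rfl

end Apply

/-! ## Units, generators, supports -/

section Relations

variable {K : Type u} [CommRing K] {n : ℕ}

/-- `T_{Λ_n}` is `T_{Cl_n}` cut down to the disjoint pairs `S ∩ T = ∅` (there `S Δ T = S ∪ T`).
[folklore] -/
theorem exteriorTensor_eq_ite_cliffordTensor (U S T : Finset (Fin n)) :
    exteriorTensor K n U S T = if Disjoint S T then cliffordTensor K n U S T else 0 := by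
  rw [exteriorTensor_apply, cliffordTensor_apply]
  by_cases h : Disjoint S T
  · rw [if_pos h, Disjoint.symmDiff_eq_sup h, Finset.sup_eq_union]
    by_cases hU : U = S ∪ T <;> simp [h, hU]
  · simp [h]

/-- `T_{Λ_n} = T_{Cl_n} ⊙ T_{D_n}` entrywise: the exterior tensor is the Clifford tensor masked by
the support of `T_{D_n}`. [folklore] -/
theorem exteriorTensor_eq_cliffordTensor_mul_dualNumberTensor (U S T : Finset (Fin n)) :
    exteriorTensor K n U S T = cliffordTensor K n U S T * dualNumberTensor K n U S T := by
  rw [exteriorTensor_eq_ite_cliffordTensor, dualNumberTensor_apply, cliffordTensor_apply]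
  by_cases h : Disjoint S T
  · rw [Disjoint.symmDiff_eq_sup h, Finset.sup_eq_union]
    by_cases hU : U = S ∪ T <;> simp [h, hU]
  · simp [h]

/-- `e_∅` is a left unit of `Cl_n`: `e_∅ ∘ e_T = e_T` (Artin 1988, Ch. V §4, p. 187).
[cite: Artin1988, Ch. V §4, p. 187] -/
theorem cliffordTensor_empty_left (U T : Finset (Fin n)) :
    cliffordTensor K n U ∅ T = if U = T then 1 else 0 := by
  simp [cliffordTensor_apply, symmDiff_def]

/-- `e_∅` is a right unit of `Cl_n`: `e_S ∘ e_∅ = e_S` (Artin 1988, Ch. V §4, p. 187).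
[cite: Artin1988, Ch. V §4, p. 187] -/
theorem cliffordTensor_empty_right (U S : Finset (Fin n)) :
    cliffordTensor K n U S ∅ = if U = S then 1 else 0 := by
  simp [cliffordTensor_apply, symmDiff_def]

/-- `e_∅ = 1` is a left unit of `Λ_n`. [folklore] -/
theorem exteriorTensor_empty_left (U T : Finset (Fin n)) :
    exteriorTensor K n U ∅ T = if U = T then 1 else 0 := by
  simp [exteriorTensor_apply]

/-- `e_∅ = 1` is a right unit of `Λ_n`. [folklore] -/
theorem exteriorTensor_empty_right (U S : Finset (Fin n)) :
    exteriorTensor K n U S ∅ = if U = S then 1 else 0 := by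
  simp [exteriorTensor_apply]

/-- Generators square to one in `Cl_n`: `A_i ∘ A_i = A_i² = 1 = e_∅` (Artin 1988, Ch. V §4,
p. 187, with `A_i² = 1`). [cite: Artin1988, Ch. V §4, p. 187] -/
theorem cliffordTensor_singleton_singleton_self (U : Finset (Fin n)) (i : Fin n) :
    cliffordTensor K n U {i} {i} = if U = ∅ then 1 else 0 := by
  simp [cliffordTensor_apply, crossInversions_singleton_singleton, symmDiff_self]

/-- Generators square to zero in `Λ_n`: `e_i ∧ e_i = 0`. [folklore] -/
theorem exteriorTensor_singleton_singleton_self (U : Finset (Fin n)) (i : Fin n) :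
    exteriorTensor K n U {i} {i} = 0 := by
  simp [exteriorTensor_apply]

/-- Distinct generators anticommute in `Cl_n`: `A_i ∘ A_j = -A_j ∘ A_i` for `i ≠ j`
(Artin 1988, Ch. V §4, p. 187: `(A_i ∘ A_j) + (A_j ∘ A_i) = (i,j) e_{(i,j)} + (j,i) e_{(i,j)} = 0`).
[cite: Artin1988, Ch. V §4, p. 187] -/
theorem cliffordTensor_singleton_swap (U : Finset (Fin n)) {i j : Fin n} (h : i ≠ j) :
    cliffordTensor K n U {i} {j} = -cliffordTensor K n U {j} {i} := by
  rw [cliffordTensor_apply, cliffordTensor_apply, crossInversions_singleton_singleton,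
    crossInversions_singleton_singleton, symmDiff_comm ({j} : Finset (Fin n)) {i}]
  by_cases hU : U = symmDiff {i} {j}
  · rw [if_pos hU, if_pos hU]
    rcases lt_or_gt_of_ne h with hij | hji
    · rw [if_neg (lt_asymm hij), if_pos hij, pow_zero, pow_one, neg_neg]
    · rw [if_pos hji, if_neg (lt_asymm hji), pow_one, pow_zero]
  · rw [if_neg hU, if_neg hU, neg_zero]

/-- Distinct generators anticommute in `Λ_n`: `e_i ∧ e_j = -e_j ∧ e_i`. [folklore] -/
theorem exteriorTensor_singleton_swap (U : Finset (Fin n)) {i j : Fin n} (h : i ≠ j) :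
    exteriorTensor K n U {i} {j} = -exteriorTensor K n U {j} {i} := by
  have hd : Disjoint ({i} : Finset (Fin n)) {j} := by simpa using h
  have hd' : Disjoint ({j} : Finset (Fin n)) {i} := by simpa using h.symm
  rw [exteriorTensor_eq_ite_cliffordTensor, exteriorTensor_eq_ite_cliffordTensor,
    cliffordTensor_singleton_swap U h, if_pos hd, if_pos hd']

end Relations

/-! ## Extension of scalars -/

section Map

variable {K : Type u} {L : Type*} {n : ℕ}

/-- `T_{Λ_n}` has entries `0, ±1`, so it is fixed by extension of scalars along any ring
homomorphism `f : K → L` (as `matMulTensor_map`). [folklore] -/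
theorem exteriorTensor_map [CommRing K] [CommRing L] (f : K →+* L) (n : ℕ) :
    (fun U S T => f (exteriorTensor K n U S T)) = exteriorTensor L n := by
  funext U S T
  simp only [exteriorTensor_apply]
  split_ifs <;> simp

/-- `T_{Cl_n}` has entries `0, ±1`, so it is fixed by extension of scalars. [folklore] -/
theorem cliffordTensor_map [CommRing K] [CommRing L] (f : K →+* L) (n : ℕ) :
    (fun U S T => f (cliffordTensor K n U S T)) = cliffordTensor L n := by
  funext U S T
  simp only [cliffordTensor_apply]
  split_ifs <;> simp

/-- `T_{D_n}` has entries `0, 1`, so it is fixed by extension of scalars. [folklore] -/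
theorem dualNumberTensor_map [CommSemiring K] [CommSemiring L] (f : K →+* L) (n : ℕ) :
    (fun U S T => f (dualNumberTensor K n U S T)) = dualNumberTensor L n := by
  funext U S T
  simp only [dualNumberTensor_apply]
  split_ifs <;> simp

/-- `T_t` has entries `0, ± t^k`, so it is fixed by the coefficientwise extension of scalars
`PowerSeries.map f : K⟦t⟧ → L⟦t⟧`. [folklore] -/
theorem reesCliffordTensor_map [CommRing K] [CommRing L] (f : K →+* L) (n : ℕ) :
    (fun U S T => PowerSeries.map f (reesCliffordTensor K n U S T)) = reesCliffordTensor L n := by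
  funext U S T
  simp only [reesCliffordTensor_apply]
  split_ifs <;> simp [PowerSeries.map_X]

end Map

/-! ## The Rees family: coefficients and the two fibres -/

section Rees

variable {K : Type u} [CommRing K] {n : ℕ}

/-- The entries of `T_t` are the monomials `T_{Cl_n}(U,S,T) · t^{|S ∩ T|}`:
`coeff_j T_t(U,S,T) = [j = |S∩T|] T_{Cl_n}(U,S,T)`. [folklore] -/
theorem coeff_reesCliffordTensor (j : ℕ) (U S T : Finset (Fin n)) :
    PowerSeries.coeff j (reesCliffordTensor K n U S T) =
      if j = (S ∩ T).card then cliffordTensor K n U S T else 0 := by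
  rw [reesCliffordTensor_apply, cliffordTensor_apply]
  have hC : (-1 : PowerSeries K) ^ crossInversions S T =
      PowerSeries.C ((-1 : K) ^ crossInversions S T) := by
    rw [map_pow, map_neg, map_one]
  by_cases hU : U = symmDiff S T
  · rw [if_pos hU, if_pos hU, hC, PowerSeries.coeff_mul_C, PowerSeries.coeff_X_pow]
    split_ifs <;> simp
  · rw [if_neg hU, if_neg hU, map_zero]
    split_ifs <;> rfl

/-- **The fibre at `t = 0` is the exterior algebra**: `T_t(U,S,T)|_{t=0} = T_{Λ_n}(U,S,T)`
(the `A_i² = t` table reduces to the `A_i² = 0` table). [folklore] -/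
theorem constantCoeff_reesCliffordTensor (U S T : Finset (Fin n)) :
    PowerSeries.constantCoeff (reesCliffordTensor K n U S T) = exteriorTensor K n U S T := by
  rw [← PowerSeries.coeff_zero_eq_constantCoeff_apply, coeff_reesCliffordTensor,
    exteriorTensor_eq_ite_cliffordTensor]
  refine if_congr ?_ rfl rfl
  rw [eq_comm, Finset.card_eq_zero, ← Finset.disjoint_iff_inter_eq_empty]

/-- Function form of `constantCoeff_reesCliffordTensor`: reducing `T_t` modulo `t` along the ring
homomorphism `constantCoeff : K⟦t⟧ → K` gives `T_{Λ_n}`. [folklore] -/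
theorem reesCliffordTensor_constantCoeff (n : ℕ) :
    (fun U S T => PowerSeries.constantCoeff (reesCliffordTensor K n U S T)) =
      exteriorTensor K n := by
  funext U S T
  exact constantCoeff_reesCliffordTensor U S T

/-- **The fibre at `t = 1` is the Clifford algebra**: the sum of the coefficients of the entry
`T_t(U,S,T)` (a monomial of degree `|S ∩ T| ≤ n`) is `T_{Cl_n}(U,S,T)` (the `A_i² = t` table at
`t = 1`). [folklore] -/
theorem sum_coeff_reesCliffordTensor (U S T : Finset (Fin n)) :
    ∑ j ∈ Finset.range (n + 1), PowerSeries.coeff j (reesCliffordTensor K n U S T) =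
      cliffordTensor K n U S T := by
  simp_rw [coeff_reesCliffordTensor]
  rw [Finset.sum_ite_eq']
  have h : (S ∩ T).card ∈ Finset.range (n + 1) := by
    rw [Finset.mem_range, Nat.lt_succ_iff]
    simpa using (S ∩ T).card_le_univ
  rw [if_pos h]

/-- On disjoint pairs the Rees entry is constant in `t`: `T_t(U,S,T) = T_{Λ_n}(U,S,T)` for
`S ∩ T = ∅`. [folklore] -/
theorem reesCliffordTensor_of_disjoint {S T : Finset (Fin n)} (h : Disjoint S T)
    (U : Finset (Fin n)) :
    reesCliffordTensor K n U S T = PowerSeries.C (exteriorTensor K n U S T) := by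
  rw [reesCliffordTensor_apply, exteriorTensor_eq_ite_cliffordTensor, if_pos h,
    cliffordTensor_apply, Finset.disjoint_iff_inter_eq_empty.mp h, Finset.card_empty, pow_zero,
    one_mul]
  split_ifs <;> simp [map_pow, map_neg, map_one]

end Rees

/-! ## Characteristic two: all signs disappear -/

section CharTwo

variable {K : Type u} [CommRing K] {n : ℕ}

/-- If `-1 = 1` in `K` then `T_{Λ_n} = T_{D_n}` (Brand–Dell–Husfeldt 2018, §4.2, Prop. 13: in
characteristic two the exterior algebra `Λ(F^k)` is the commutative group algebra `F[ℤ_2^k]`).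
[cite: BrandDellHusfeldt2018, §4.2, Prop. 13] -/
theorem exteriorTensor_eq_dualNumberTensor_of_neg_one_eq_one (h : (-1 : K) = 1) (n : ℕ) :
    exteriorTensor K n = dualNumberTensor K n := by
  funext U S T
  simp [exteriorTensor_apply, dualNumberTensor_apply, h]

/-- Over `ZMod 2`, `T_{Λ_n} = T_{D_n}`: the fermionic sign is invisible mod `2`.
[cite: BrandDellHusfeldt2018, §4.2, Prop. 13] -/
theorem exteriorTensor_zmod_two (n : ℕ) : exteriorTensor (ZMod 2) n = dualNumberTensor (ZMod 2) n :=
  exteriorTensor_eq_dualNumberTensor_of_neg_one_eq_one (by decide) n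

/-- If `-1 = 1` in `K` then `T_{Cl_n}` agrees with `T_{D_n}` on disjoint pairs. [folklore] -/
theorem cliffordTensor_eq_dualNumberTensor_of_disjoint (h : (-1 : K) = 1) {S T : Finset (Fin n)}
    (hST : Disjoint S T) (U : Finset (Fin n)) :
    cliffordTensor K n U S T = dualNumberTensor K n U S T := by
  rw [← exteriorTensor_eq_dualNumberTensor_of_neg_one_eq_one h,
    exteriorTensor_eq_ite_cliffordTensor, if_pos hST]

/-- Over `ZMod 2`, `T_{Cl_n}` restricted to the disjoint pairs is `T_{D_n}`. [folklore] -/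
theorem ite_disjoint_cliffordTensor_zmod_two (n : ℕ) :
    (fun U S T : Finset (Fin n) => if Disjoint S T then cliffordTensor (ZMod 2) n U S T else 0) =
      dualNumberTensor (ZMod 2) n := by
  rw [← exteriorTensor_zmod_two]
  funext U S T
  exact (exteriorTensor_eq_ite_cliffordTensor U S T).symm

end CharTwo

/-! ## Faithfulness: `T_{Λ_n}` is the structure tensor of Mathlib's exterior algebra -/

section Faithful

open _root_.Literature.MathematicalPhysics.QuantumLattice

variable {K : Type u} [CommRing K] {M : Type*} [AddCommGroup M] [Module K M] {n : ℕ}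

/-- `e_∅ = 1` in Mathlib's basis of the exterior algebra. [folklore] -/
theorem basis_exteriorAlgebra_empty (b : Module.Basis (Fin n) K M) :
    b.ExteriorAlgebra ∅ = 1 := by
  rw [basisExteriorAlgebra_eq_ιMulti b Finset.card_empty, ExteriorAlgebra.ιMulti_zero_apply]

/-- **Multiplication table of the exterior algebra in Mathlib's basis** `b.ExteriorAlgebra`
(wedges of basis vectors in increasing order): `e_S · e_T = (-1)^{inv(S,T)} e_{S∪T}` if
`S ∩ T = ∅` and `0` otherwise (Brand–Dell–Husfeldt 2018, §2.1; Artin 1988, Ch. V §4 with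
`A_i² = 0`). By induction on `S` along its minimum, using `e_{S ∪ {a}} = e_a · e_S` for `a < S` and
`e_a · e_R = [a ∉ R] (-1)^{#{r ∈ R : r < a}} e_{R ∪ {a}}` (`ι_mul_basisExteriorAlgebra`).
[cite: BrandDellHusfeldt2018, §2.1] -/
theorem basis_exteriorAlgebra_mul (b : Module.Basis (Fin n) K M) (S T : Finset (Fin n)) :
    b.ExteriorAlgebra S * b.ExteriorAlgebra T =
      if Disjoint S T then ((-1 : K) ^ crossInversions S T) • b.ExteriorAlgebra (S ∪ T) else 0 := by
  induction S using Finset.induction_on_min with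
  | empty => simp [basis_exteriorAlgebra_empty]
  | insert a S ha ih =>
    have haS : a ∉ S := fun h => lt_irrefl a (ha a h)
    rw [basisExteriorAlgebra_insert_of_forall_lt b a S ha, mul_assoc, ih]
    by_cases hST : Disjoint S T
    · rw [if_pos hST, mul_smul_comm, ι_mul_basisExteriorAlgebra b a (S ∪ T)]
      by_cases haT : a ∈ T
      · have hnot : ¬Disjoint (insert a S) T := fun h =>
          (Finset.disjoint_insert_left.mp h).1 haT
        rw [if_pos (Finset.mem_union_right S haT), smul_zero, if_neg hnot]
      · have hdisj : Disjoint (insert a S) T := Finset.disjoint_insert_left.mpr ⟨haT, hST⟩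
        have hmem : a ∉ S ∪ T := by simp [haS, haT]
        have hfil : (S ∪ T).filter (· < a) = T.filter (· < a) := by
          ext x
          simp only [Finset.mem_filter, Finset.mem_union]
          constructor
          · rintro ⟨hx | hx, hxa⟩
            · exact absurd hxa (lt_asymm (ha x hx))
            · exact ⟨hx, hxa⟩
          · rintro ⟨hx, hxa⟩
            exact ⟨Or.inr hx, hxa⟩
        rw [if_neg hmem, if_pos hdisj, smul_smul, hfil, Finset.insert_union,
          crossInversions_insert_left haS, pow_add, mul_comm]
    · have hnot : ¬Disjoint (insert a S) T := fun h =>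
        hST (Finset.disjoint_insert_left.mp h).2
      rw [if_neg hST, mul_zero, if_neg hnot]

/-- **`T_{Λ_n}` is the structure tensor of the exterior algebra.** For every basis `b` of a
`K`-module `M` indexed by `Fin n`, the structure tensor (BCS 1997, Def. (14.17); output index
first) of `ExteriorAlgebra K M` in Mathlib's basis `b.ExteriorAlgebra`, indexed by
`Finset (Fin n)`, is `exteriorTensor K n`. [cite: BurgisserClausenShokrollahi1997, Def. (14.17)] -/
theorem structureTensor_basis_exteriorAlgebra (b : Module.Basis (Fin n) K M) :
    structureTensor b.ExteriorAlgebra = exteriorTensor K n := by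
  funext U S T
  rw [structureTensor_apply, basis_exteriorAlgebra_mul, exteriorTensor_apply]
  by_cases hST : Disjoint S T
  · rw [if_pos hST, map_smul, Finsupp.smul_apply, Module.Basis.repr_self, smul_eq_mul,
      Finsupp.single_apply]
    by_cases hU : U = S ∪ T
    · simp [hST, hU]
    · rw [if_neg (Ne.symm hU), if_neg (fun h => hU h.2), mul_zero]
  · simp [hST]

/-- In particular for the coordinate space `K^n` with its standard basis: the structure tensor of
`Λ(K^n)` in the basis `e_S = e_{s_1} ∧ ⋯ ∧ e_{s_k}` is `T_{Λ_n}`. [folklore] -/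
theorem structureTensor_basisFun_exteriorAlgebra (n : ℕ) :
    structureTensor (Pi.basisFun K (Fin n)).ExteriorAlgebra = exteriorTensor K n :=
  structureTensor_basis_exteriorAlgebra _

end Faithful

end Literature.Computability.AlgebraicComplexity
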